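import Mathlib
import Summits.Ventures.PercRepro2.OneEdge
import Summits.Ventures.PercRepro2.KPrimeReduction
import Summits.Ventures.PercRepro2.KPrimeSure
import Summits.Ventures.PercRepro2.KPrimeEdgeSteps
import Summits.Ventures.PercRepro2.KPrimeVEdge
import Summits.Ventures.PercRepro2.KPrimeVBase
import Summits.Ventures.PercRepro2.KPrimeLambdaDefs

/-!
# The potential `Λ` along the `v`-exploration: the special edges, the base case, the degenerate cases
(blind cell PercRepro2, mine-c g33; `conjectures/MINE-C.md` §42.8)

With `Λ = Φ_K − base` (`KPrimeLambdaDefs.lean`):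

* `prob_Ωc_eq_scale`: the `Ω_c`-masses scale by `1 − p e` under pinning an edge `e` leaving the root
  of `v` closed (`Ω_c` needs `e` closed), and `Ω_c` is the same event for `p` and `p[e ↦ 0]`;
* `lamHolds_of_update_zero_va₂`: an edge from the root of `v` into the root of `a₂`:
  `lamForm(p) = (1 − p e)³ · lamForm(p[e ↦ 0])`;
* `lamHolds_of_update_zero_va₁`: an edge from the root of `v` into the root of `a₁`:
  `lamForm(p) = (1 − p e)³ · lamForm(p[e ↦ 0]) + p e (1 − p e)² · P⁰(N) · P⁰(Ω_c) · (BHK slack)`;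
* `lam_of_exhausted_v`: the base case — `Λ = 0` when `b` is outside the root of `v`, `Λ = Φ_K ≥ 0`
  when `b` is inside;
* `lamHolds_of_a₁_mem_root_v`, `lamHolds_of_a₂_mem_root_v`: the degenerate cases (`Λ = 0`).
-/

namespace Summit.Ventures.PercRepro2

namespace KPrime

variable {V : Type*} {E : Type*} [Fintype E] [DecidableEq E] [Fintype V] [DecidableEq V]
  {R : Type*} [Field R] [LinearOrder R] [IsStrictOrderedRing R]

section LamScale

variable {ends : E → Sym2 V} {a₁ a₂ v : V} {p : E → R} {e : E}

omit [Fintype E] [Fintype V] [DecidableEq V] [IsStrictOrderedRing R] in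
/-- Pinning an unresolved edge closed does not change the weight-`1` root. -/
lemma root_update_zero (he : p e ≠ 1) (w : V) :
    root (Function.update p e 0) ends w = root p ends w := by
  have : oneConfig (Function.update p e 0) = oneConfig p := by
    funext f
    by_cases hf : f = e
    · subst hf; simp [oneConfig, he]
    · simp [oneConfig, Function.update_of_ne hf]
  simp only [root, this]

omit [Fintype V] [DecidableEq V] [IsStrictOrderedRing R] in
/-- Pinning an unresolved edge closed does not change `Ω_c`. -/
lemma Ωc_update_zero (he : p e ≠ 1) :
    Ωc (Function.update p e 0) ends a₁ a₂ v = Ωc p ends a₁ a₂ v := by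
  have hr := root_update_zero (ends := ends) he v
  have hL : Leaving (Function.update p e 0) ends v = Leaving p ends v := by
    funext f; simp only [Leaving, hr]
  classical
  ext ω
  simp only [Ωc, vClosed, closedAll, leavingSet, Set.mem_inter_iff, Set.mem_setOf_eq,
    Finset.mem_filter, Finset.mem_univ, true_and, hL]

omit [DecidableEq E] [Fintype V] [DecidableEq V] [IsStrictOrderedRing R] in
/-- An edge leaving the root of `v` is closed on `Ω_c`. -/
lemma eq_false_of_mem_Ωc {x z : V} (hends : ends e = s(x, z)) (hx : x ∈ root p ends v)
    (hz : z ∉ root p ends v) {ω : Config E} (hω : ω ∈ Ωc p ends a₁ a₂ v) : ω e = false := by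
  classical
  have hl : Leaving p ends v e := ⟨x, z, hends, hx, hz⟩
  have hmem : e ∈ leavingSet p ends v := by simp [leavingSet, hl]
  exact hω.2 e hmem

omit [Fintype V] [DecidableEq V] [IsStrictOrderedRing R] in
/-- An event inside `Ω_c` is null once an edge leaving the root of `v` is pinned open. -/
lemma prob_update_one_eq_zero_of_subset_Ωc {x z : V} (hends : ends e = s(x, z))
    (hx : x ∈ root p ends v) (hz : z ∉ root p ends v) {A : Set (Config E)}
    (hA : A ⊆ Ωc p ends a₁ a₂ v) : prob (Function.update p e 1) A = 0 := by
  apply prob_eq_zero_of_inter_sureSet_eq_empty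
  ext ω
  simp only [Set.mem_inter_iff, Set.mem_empty_iff_false, iff_false, not_and]
  intro hωA hω
  have h1 : ω e = true := hω.1 e (by simp)
  rw [eq_false_of_mem_Ωc hends hx hz (hA hωA)] at h1
  exact Bool.false_ne_true h1

omit [Fintype V] [DecidableEq V] [IsStrictOrderedRing R] in
/-- An event inside `Ω_c` has mass `(1 − p e)` times its mass with the edge pinned closed. -/
lemma prob_eq_scale_of_subset_Ωc {x z : V} (hends : ends e = s(x, z)) (hx : x ∈ root p ends v)
    (hz : z ∉ root p ends v) {A : Set (Config E)} (hA : A ⊆ Ωc p ends a₁ a₂ v) :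
    prob p A = (1 - p e) * prob (Function.update p e 0) A := by
  rw [prob_eq_pin p A e, prob_update_one_eq_zero_of_subset_Ωc hends hx hz hA, mul_zero, zero_add]

end LamScale

section LamEdges

variable {ends : E → Sym2 V} {a₁ a₂ b v y : V} {p : E → R} {e : E}

omit [Fintype E] [DecidableEq E] [Fintype V] [DecidableEq V] [IsStrictOrderedRing R] in
/-- A root vertex of `a₂` is not a root vertex of `v` unless `a₂` is. -/
lemma not_mem_root_v_of_mem_root_a₂ {z : V} (hz : z ∈ root p ends a₂) (h2 : a₂ ∉ root p ends v) :
    z ∉ root p ends v := fun hzv => h2 (conn_trans hzv (conn_symm hz))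

omit [Fintype E] [DecidableEq E] [Fintype V] [DecidableEq V] [IsStrictOrderedRing R] in
/-- A root vertex of `a₁` is not a root vertex of `v` unless `a₁` is. -/
lemma not_mem_root_v_of_mem_root_a₁ {z : V} (hz : z ∈ root p ends a₁) (h1 : a₁ ∉ root p ends v) :
    z ∉ root p ends v := fun hzv => h1 (conn_trans hzv (conn_symm hz))

omit [Fintype V] in
/-- **An edge from the root of `v` into the root of `a₂` keeps `Λ ≥ 0`**:
`lamForm(p) = (1 − p e)³ · lamForm(p[e ↦ 0])`. -/
theorem lamHolds_of_update_zero_va₂ (hp : IsProbVec p) {x z : V} (hends : ends e = s(x, z))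
    (hx : x ∈ root p ends v) (hz : z ∈ root p ends a₂) (h2 : a₂ ∉ root p ends v) (he : p e ≠ 1)
    (h0 : LamHolds (Function.update p e 0) ends a₁ a₂ b v y) :
    LamHolds p ends a₁ a₂ b v y := by
  have hzv : z ∉ root p ends v := not_mem_root_v_of_mem_root_a₂ hz h2
  have sc : ∀ A : Set (Config E), A ⊆ S ends a₁ a₂ v →
      prob p A = (1 - p e) * prob (Function.update p e 0) A :=
    fun A hA => prob_eq_scale_of_subset_S_va₂ hends hx hz he hA
  have scΩ : ∀ A : Set (Config E), A ⊆ Ωc p ends a₁ a₂ v →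
      prob p A = (1 - p e) * prob (Function.update p e 0) A :=
    fun A hA => prob_eq_scale_of_subset_Ωc (a₁ := a₁) (a₂ := a₂) hends hx hzv hA
  have hUΩ : connEvent ends a₁ v ∩ Ω ends a₁ a₂ ⊆ S ends a₁ a₂ v := by
    rw [U_inter_Ω_eq]; exact Set.inter_subset_right
  have hN : prob p (N ends a₁ a₂ v) = prob (Function.update p e 0) (N ends a₁ a₂ v) :=
    prob_eq_of_flip_invariant he (N_flip_invariant_va₂ hends hx hz he)
  have hXN : prob p (connEvent ends a₁ b ∩ N ends a₁ a₂ v) =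
      prob (Function.update p e 0) (connEvent ends a₁ b ∩ N ends a₁ a₂ v) :=
    prob_eq_of_flip_invariant he (XN_flip_invariant_va₂ hends hx hz he)
  unfold LamHolds lamForm baseBracket kprimeForm at h0 ⊢
  rw [Ωc_update_zero he] at h0
  have s1 : connEvent ends a₁ v ∩ connEvent ends a₁ b ∩ Ω ends a₁ a₂ ⊆ S ends a₁ a₂ v := by
    intro ω hω; exact hUΩ ⟨hω.1.1, hω.2⟩
  have s7 : connEvent ends a₁ v ∩ connEvent ends a₂ y ∩ connEvent ends a₁ b ∩ Ω ends a₁ a₂ ⊆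
      S ends a₁ a₂ v := by
    intro ω hω; exact hUΩ ⟨hω.1.1.1, hω.2⟩
  have s8 : connEvent ends a₁ v ∩ connEvent ends a₂ y ∩ Ω ends a₁ a₂ ⊆ S ends a₁ a₂ v := by
    intro ω hω; exact hUΩ ⟨hω.1.1, hω.2⟩
  rw [sc _ s1, sc _ hUΩ, sc _ Set.inter_subset_right, sc _ (subset_refl _), sc _ cls01e_subset_S,
    sc _ cls01_subset_S, sc _ s7, sc _ s8, hN, hXN, scΩ _ (subset_refl _),
    scΩ _ Set.inter_subset_right, scΩ _ Set.inter_subset_right, scΩ _ Set.inter_subset_right]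
  have h1t : 0 ≤ 1 - p e := sub_nonneg.2 (hp.le_one e)
  have h3 : 0 ≤ (1 - p e) ^ 3 := pow_nonneg h1t 3
  nlinarith [mul_nonneg h3 h0]

/-- **An edge from the root of `v` into the root of `a₁` keeps `Λ ≥ 0`**:
`lamForm(p) = (1 − p e)³ · lamForm(p[e ↦ 0]) + p e (1 − p e)² · P⁰(N) · P⁰(Ω_c) · (BHK slack)`. -/
theorem lamHolds_of_update_zero_va₁ (hp : IsProbVec p) {x z : V} (hends : ends e = s(x, z))
    (hx : x ∈ root p ends v) (hz : z ∈ root p ends a₁) (h1 : a₁ ∉ root p ends v) (he : p e ≠ 1)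
    (h0 : LamHolds (Function.update p e 0) ends a₁ a₂ b v y) :
    LamHolds p ends a₁ a₂ b v y := by
  have hzv : z ∉ root p ends v := not_mem_root_v_of_mem_root_a₁ hz h1
  -- the masses that vanish with `e` pinned open: `N`, `X ∩ N`, `(0,1)`, `(0,1)ᵉ`, and the `Ω_c`-masses
  have sc : ∀ A : Set (Config E), A ⊆ (connEvent ends a₁ v)ᶜ →
      prob p A = (1 - p e) * prob (Function.update p e 0) A :=
    fun A hA => prob_eq_scale_of_subset_Uc hends hx hz he hA
  have scΩ : ∀ A : Set (Config E), A ⊆ Ωc p ends a₁ a₂ v →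
      prob p A = (1 - p e) * prob (Function.update p e 0) A :=
    fun A hA => prob_eq_scale_of_subset_Ωc (a₁ := a₁) (a₂ := a₂) hends hx hzv hA
  have hN : N ends a₁ a₂ v ⊆ (connEvent ends a₁ v)ᶜ := fun ω hω => (mem_N.1 hω).2
  have hXN : connEvent ends a₁ b ∩ N ends a₁ a₂ v ⊆ (connEvent ends a₁ v)ᶜ :=
    fun ω hω => hN hω.2
  have h01 : cls01 ends a₁ a₂ v y ⊆ (connEvent ends a₁ v)ᶜ := fun ω hω => hω.1.1
  have h01e : cls01e ends a₁ a₂ b v y ⊆ (connEvent ends a₁ v)ᶜ := fun ω hω => hω.1.1.1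
  have hS1 : prob (Function.update p e 1) (S ends a₁ a₂ v) =
      prob (Function.update p e 0) (S ends a₁ a₂ v) :=
    prob_update_one_eq_update_zero he (S_flip_invariant_va₁ hends hx hz he)
  have hYS1 : prob (Function.update p e 1) (connEvent ends a₂ y ∩ S ends a₁ a₂ v) =
      prob (Function.update p e 0) (connEvent ends a₂ y ∩ S ends a₁ a₂ v) :=
    prob_update_one_eq_update_zero he (YS_flip_invariant_va₁ hends hx hz he)
  have hU : ∀ A : Set (Config E), prob (Function.update p e 1) (connEvent ends a₁ v ∩ A) =
      prob (Function.update p e 1) A := fun A => prob_update_one_inter_U hends hx hz he A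
  have e1 : connEvent ends a₁ v ∩ connEvent ends a₁ b ∩ Ω ends a₁ a₂ =
      connEvent ends a₁ v ∩ (connEvent ends a₁ b ∩ S ends a₁ a₂ v) := by
    rw [Set.inter_assoc, Set.inter_comm (connEvent ends a₁ b), ← Set.inter_assoc, U_inter_Ω_eq,
      Set.inter_assoc, Set.inter_comm (S ends a₁ a₂ v)]
  have e2 : connEvent ends a₁ v ∩ connEvent ends a₂ y ∩ connEvent ends a₁ b ∩ Ω ends a₁ a₂ =
      connEvent ends a₁ v ∩ (connEvent ends a₂ y ∩ connEvent ends a₁ b ∩ S ends a₁ a₂ v) := by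
    ext ω
    simp only [Set.mem_inter_iff, mem_connEvent, mem_Ω, mem_S]
    constructor
    · rintro ⟨⟨⟨hu, hy⟩, hb⟩, hΩ⟩
      exact ⟨hu, ⟨hy, hb⟩, fun h => hΩ (conn_symm h), fun h => hΩ (conn_trans hu (conn_symm h))⟩
    · rintro ⟨hu, ⟨hy, hb⟩, h1', _⟩
      exact ⟨⟨⟨hu, hy⟩, hb⟩, fun h => h1' (conn_symm h)⟩
  have e3 : connEvent ends a₁ v ∩ connEvent ends a₂ y ∩ Ω ends a₁ a₂ =
      connEvent ends a₁ v ∩ (connEvent ends a₂ y ∩ S ends a₁ a₂ v) := by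
    ext ω
    simp only [Set.mem_inter_iff, mem_connEvent, mem_Ω, mem_S]
    constructor
    · rintro ⟨⟨hu, hy⟩, hΩ⟩
      exact ⟨hu, hy, fun h => hΩ (conn_symm h), fun h => hΩ (conn_trans hu (conn_symm h))⟩
    · rintro ⟨hu, hy, h1', _⟩
      exact ⟨⟨hu, hy⟩, fun h => h1' (conn_symm h)⟩
  have e4 : connEvent ends a₁ v ∩ Ω ends a₁ a₂ = connEvent ends a₁ v ∩ S ends a₁ a₂ v :=
    U_inter_Ω_eq
  have hp1 : IsProbVec (Function.update p e 1) := hp.update e zero_le_one le_rfl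
  have ha₁ : a₁ ∈ ({a₁, v} : Finset V) := by simp
  have hB := bhk_cross_cluster_avoid (Function.update p e 1) hp1 ends a₂ a₁ (X := {a₁, v}) ha₁
    (isUpperSet_mem y) (isUpperSet_mem b)
  rw [clusterInEvent_mem_eq, clusterInEvent_mem_eq] at hB
  change prob (Function.update p e 1) (connEvent ends a₂ y ∩ connEvent ends a₁ b ∩ S ends a₁ a₂ v) *
      prob (Function.update p e 1) (S ends a₁ a₂ v) ≤
    prob (Function.update p e 1) (connEvent ends a₂ y ∩ S ends a₁ a₂ v) *
      prob (Function.update p e 1) (connEvent ends a₁ b ∩ S ends a₁ a₂ v) at hB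
  have hA1 : prob (Function.update p e 1) (connEvent ends a₁ v ∩ connEvent ends a₁ b ∩ Ω ends a₁ a₂) =
      prob (Function.update p e 1) (connEvent ends a₁ b ∩ S ends a₁ a₂ v) := by rw [e1, hU]
  have hH1 : prob (Function.update p e 1) (connEvent ends a₁ v ∩ Ω ends a₁ a₂) =
      prob (Function.update p e 1) (S ends a₁ a₂ v) := by rw [e4, hU]
  have hC1 : prob (Function.update p e 1)
      (connEvent ends a₁ v ∩ connEvent ends a₂ y ∩ connEvent ends a₁ b ∩ Ω ends a₁ a₂) =
      prob (Function.update p e 1) (connEvent ends a₂ y ∩ connEvent ends a₁ b ∩ S ends a₁ a₂ v) := by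
    rw [e2, hU]
  have hD1 : prob (Function.update p e 1) (connEvent ends a₁ v ∩ connEvent ends a₂ y ∩ Ω ends a₁ a₂) =
      prob (Function.update p e 1) (connEvent ends a₂ y ∩ S ends a₁ a₂ v) := by rw [e3, hU]
  unfold LamHolds lamForm baseBracket kprimeForm at h0 ⊢
  rw [Ωc_update_zero he] at h0
  rw [sc _ hN, sc _ hXN, sc _ h01, sc _ h01e]
  rw [prob_eq_pin p (connEvent ends a₁ v ∩ connEvent ends a₁ b ∩ Ω ends a₁ a₂) e,
    prob_eq_pin p (connEvent ends a₁ v ∩ Ω ends a₁ a₂) e,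
    prob_eq_pin p (connEvent ends a₂ y ∩ S ends a₁ a₂ v) e,
    prob_eq_pin p (S ends a₁ a₂ v) e,
    prob_eq_pin p (connEvent ends a₁ v ∩ connEvent ends a₂ y ∩ connEvent ends a₁ b ∩ Ω ends a₁ a₂) e,
    prob_eq_pin p (connEvent ends a₁ v ∩ connEvent ends a₂ y ∩ Ω ends a₁ a₂) e]
  rw [hA1, hH1, hC1, hD1, hS1, hYS1]
  rw [hS1, hYS1] at hB
  rw [scΩ _ (subset_refl _), scΩ _ Set.inter_subset_right, scΩ _ Set.inter_subset_right,
    scΩ _ Set.inter_subset_right]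
  have h1t : 0 ≤ 1 - p e := sub_nonneg.2 (hp.le_one e)
  have ht : 0 ≤ p e := hp.nonneg e
  have hD : 0 ≤ prob (Function.update p e 0) (N ends a₁ a₂ v) :=
    prob_nonneg (hp.update e le_rfl zero_le_one) _
  have hOc : 0 ≤ prob (Function.update p e 0) (Ωc p ends a₁ a₂ v) :=
    prob_nonneg (hp.update e le_rfl zero_le_one) _
  have h3 : 0 ≤ (1 - p e) ^ 3 := pow_nonneg h1t 3
  have h2 : 0 ≤ (1 - p e) ^ 2 := pow_nonneg h1t 2
  nlinarith [mul_nonneg h3 h0,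
    mul_nonneg (mul_nonneg (mul_nonneg (mul_nonneg ht h2) hD) hOc) (sub_nonneg.2 hB)]

end LamEdges

section LamBase

variable {ends : E → Sym2 V} {a₁ a₂ b v y : V} {p : E → R}

omit [Fintype V] [IsStrictOrderedRing R] in
/-- `a₁` in the root of `v`: `N` is null, so `N₀ = D₀ = 0` and `lamForm = 0`. -/
theorem lamHolds_of_a₁_mem_root_v (h1 : a₁ ∈ root p ends v) : LamHolds p ends a₁ a₂ b v y := by
  have hN : N ends a₁ a₂ v ∩ sureSet p = ∅ := by
    ext ω
    simp only [Set.mem_inter_iff, Set.mem_empty_iff_false, iff_false, not_and]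
    intro hω hs
    exact (mem_N.1 hω).2 (conn_symm (conn_of_mem_root p hs h1))
  have hN0 : prob p (N ends a₁ a₂ v) = 0 := prob_eq_zero_of_inter_sureSet_eq_empty p hN
  have hXN0 : prob p (connEvent ends a₁ b ∩ N ends a₁ a₂ v) = 0 := by
    apply prob_eq_zero_of_inter_sureSet_eq_empty
    rw [Set.inter_assoc, hN, Set.inter_empty]
  unfold LamHolds lamForm kprimeForm
  rw [hN0, hXN0]
  simp

omit [Fintype V] [IsStrictOrderedRing R] in
/-- `a₂` in the root of `v`: `S` is null, so every `S`-mass is `0` and `lamForm = 0`. -/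
theorem lamHolds_of_a₂_mem_root_v (h2 : a₂ ∈ root p ends v) : LamHolds p ends a₁ a₂ b v y := by
  have hS : S ends a₁ a₂ v ∩ sureSet p = ∅ := by
    ext ω
    simp only [Set.mem_inter_iff, Set.mem_empty_iff_false, iff_false, not_and]
    intro hω hs
    exact (mem_S.1 hω).2 (conn_symm (conn_of_mem_root p hs h2))
  have hS0 : prob p (S ends a₁ a₂ v) = 0 := prob_eq_zero_of_inter_sureSet_eq_empty p hS
  have hYS0 : prob p (connEvent ends a₂ y ∩ S ends a₁ a₂ v) = 0 := by
    apply prob_eq_zero_of_inter_sureSet_eq_empty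
    rw [Set.inter_assoc, hS, Set.inter_empty]
  unfold LamHolds lamForm kprimeForm
  rw [hS0, hYS0]
  simp

omit [DecidableEq V] [IsStrictOrderedRing R] in
/-- Exhausted at the root of `v`: on the sure set every edge leaving the root is closed, so an
event intersected with `Ω_c` has the mass of its intersection with `Ω`. -/
lemma prob_inter_Ωc_eq_of_exhausted (hex : Exhausted p ends v) (A : Set (Config E)) :
    prob p (A ∩ Ωc p ends a₁ a₂ v) = prob p (A ∩ Ω ends a₁ a₂) := by
  classical
  apply prob_congr_sure
  ext ω
  simp only [Ωc, vClosed, closedAll, leavingSet, Leaving, Set.mem_inter_iff, Set.mem_setOf_eq,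
    Finset.mem_filter, Finset.mem_univ, true_and]
  constructor
  · rintro ⟨⟨hA, hΩ, _⟩, hs⟩; exact ⟨⟨hA, hΩ⟩, hs⟩
  · rintro ⟨⟨hA, hΩ⟩, hs⟩
    refine ⟨⟨hA, hΩ, fun f hf => ?_⟩, hs⟩
    obtain ⟨x, z, hends, hx, hz⟩ := hf
    exact hs.2 f (hex f x z hends hx hz)

/-- **The base case of the `Λ`-induction**: the root of `v` exhausted and `a₁`, `a₂` outside it give
`Λ ≥ 0` — `Λ = 0` when `b` is outside the root (`Φ_K = base`), `Λ = Φ_K ≥ 0` when `b` is inside. -/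
theorem lam_of_exhausted_v (hp : IsProbVec p) (hex : Exhausted p ends v)
    (h1 : a₁ ∉ root p ends v) (h2 : a₂ ∉ root p ends v) : LamHolds p ends a₁ a₂ b v y := by
  have sf := fun {ω : Config E} (hω : ω ∈ sureSet p) => sure_facts_v hex h1 h2 hω
  have hU0 : ∀ A : Set (Config E), prob p (connEvent ends a₁ v ∩ A) = 0 := by
    intro A
    apply prob_eq_zero_of_inter_sureSet_eq_empty
    ext ω
    simp only [Set.mem_inter_iff, Set.mem_empty_iff_false, iff_false, not_and, mem_connEvent]
    intro hu hs
    exact (sf hs).1 hu.1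
  have z1 : prob p (connEvent ends a₁ v ∩ connEvent ends a₁ b ∩ Ω ends a₁ a₂) = 0 := by
    rw [Set.inter_assoc]; exact hU0 _
  have z2 : prob p (connEvent ends a₁ v ∩ Ω ends a₁ a₂) = 0 := hU0 _
  have z3 : prob p (connEvent ends a₁ v ∩ connEvent ends a₂ y ∩ connEvent ends a₁ b ∩
      Ω ends a₁ a₂) = 0 := by
    rw [Set.inter_assoc, Set.inter_assoc]; exact hU0 _
  have z4 : prob p (connEvent ends a₁ v ∩ connEvent ends a₂ y ∩ Ω ends a₁ a₂) = 0 := by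
    rw [Set.inter_assoc]; exact hU0 _
  have eS : prob p (S ends a₁ a₂ v) = prob p (Ω ends a₁ a₂) := by
    apply prob_congr_sure
    ext ω
    simp only [Set.mem_inter_iff, mem_S, mem_Ω]
    constructor
    · rintro ⟨⟨ha, _⟩, hs⟩; exact ⟨fun h => ha (conn_symm h), hs⟩
    · rintro ⟨ha, hs⟩; exact ⟨⟨fun h => ha (conn_symm h), (sf hs).2⟩, hs⟩
  have eN : prob p (N ends a₁ a₂ v) = prob p (Ω ends a₁ a₂) := by
    apply prob_congr_sure
    ext ω
    simp only [Set.mem_inter_iff, mem_N, mem_Ω]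
    constructor
    · rintro ⟨⟨ha, _⟩, hs⟩; exact ⟨ha, hs⟩
    · rintro ⟨ha, hs⟩; exact ⟨⟨ha, (sf hs).1⟩, hs⟩
  have eXN : prob p (connEvent ends a₁ b ∩ N ends a₁ a₂ v) =
      prob p (connEvent ends a₁ b ∩ Ω ends a₁ a₂) := by
    apply prob_congr_sure
    ext ω
    simp only [Set.mem_inter_iff, mem_N, mem_Ω]
    constructor
    · rintro ⟨⟨hb, ha, _⟩, hs⟩; exact ⟨⟨hb, ha⟩, hs⟩
    · rintro ⟨⟨hb, ha⟩, hs⟩; exact ⟨⟨hb, ha, (sf hs).1⟩, hs⟩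
  have e01 : prob p (cls01 ends a₁ a₂ v y) = prob p (connEvent ends a₁ y ∩ Ω ends a₁ a₂) := by
    apply prob_congr_sure
    ext ω
    simp only [cls01, Set.mem_inter_iff, Set.mem_compl_iff, mem_connEvent, mem_S, mem_Ω]
    constructor
    · rintro ⟨⟨⟨_, hy⟩, ha, _⟩, hs⟩; exact ⟨⟨hy, fun h => ha (conn_symm h)⟩, hs⟩
    · rintro ⟨⟨hy, ha⟩, hs⟩
      exact ⟨⟨⟨(sf hs).1, hy⟩, fun h => ha (conn_symm h), (sf hs).2⟩, hs⟩
  have cΩ : ∀ A : Set (Config E), prob p (A ∩ Ωc p ends a₁ a₂ v) = prob p (A ∩ Ω ends a₁ a₂) :=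
    fun A => prob_inter_Ωc_eq_of_exhausted (a₁ := a₁) (a₂ := a₂) hex A
  have cΩ' : prob p (Ωc p ends a₁ a₂ v) = prob p (Ω ends a₁ a₂) := by
    have := cΩ Set.univ; simpa only [Set.univ_inter] using this
  have hpΩ := prob_nonneg hp (Ω ends a₁ a₂)
  unfold LamHolds lamForm baseBracket kprimeForm
  rw [z1, z2, z3, z4, eS, eN, eXN, e01, cΩ, cΩ, cΩ, cΩ']
  by_cases hb : b ∈ root p ends v
  · -- `b` in the root of `v`: `X` is impossible on the sure set, the bracket vanishes, `Λ = Φ_K ≥ 0`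
    have hX0 : ∀ A : Set (Config E), prob p (connEvent ends a₁ b ∩ A) = 0 := by
      intro A
      apply prob_eq_zero_of_inter_sureSet_eq_empty
      ext ω
      simp only [Set.mem_inter_iff, Set.mem_empty_iff_false, iff_false, not_and, mem_connEvent]
      intro hbb hs
      exact (sf hs).1 (conn_trans hbb.1 (conn_symm (conn_of_mem_root p hs hb)))
    have e01e : prob p (cls01e ends a₁ a₂ b v y) =
        prob p (connEvent ends a₁ y ∩ Ω ends a₁ a₂) := by
      apply prob_congr_sure
      ext ω
      simp only [cls01e, Set.mem_inter_iff, Set.mem_compl_iff, Set.mem_union, mem_connEvent,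
        mem_S, mem_Ω]
      constructor
      · rintro ⟨⟨⟨⟨_, hy⟩, ha, _⟩, _⟩, hs⟩; exact ⟨⟨hy, fun h => ha (conn_symm h)⟩, hs⟩
      · rintro ⟨⟨hy, ha⟩, hs⟩
        exact ⟨⟨⟨⟨(sf hs).1, hy⟩, fun h => ha (conn_symm h), (sf hs).2⟩,
          Or.inr (conn_of_mem_root p hs hb)⟩, hs⟩
    have hXW : prob p (connEvent ends a₁ b ∩ connEvent ends a₁ y ∩ Ω ends a₁ a₂) = 0 := by
      rw [Set.inter_assoc]; exact hX0 _
    have hXΩ : prob p (connEvent ends a₁ b ∩ Ω ends a₁ a₂) = 0 := hX0 _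
    rw [e01e, hXW, hXΩ]
    have hW := prob_nonneg hp (connEvent ends a₁ y ∩ Ω ends a₁ a₂)
    nlinarith [mul_nonneg (mul_nonneg (mul_nonneg hpΩ hpΩ) hpΩ) hW]
  · -- `b` outside the root of `v`: the glued class is `{b, y ∈ C₁} ∩ Ω` and `Λ = 0`
    have e01e : prob p (cls01e ends a₁ a₂ b v y) =
        prob p (connEvent ends a₁ b ∩ connEvent ends a₁ y ∩ Ω ends a₁ a₂) := by
      apply prob_congr_sure
      ext ω
      simp only [cls01e, Set.mem_inter_iff, Set.mem_compl_iff, Set.mem_union, mem_connEvent,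
        mem_S, mem_Ω]
      constructor
      · rintro ⟨⟨⟨⟨_, hy⟩, ha, _⟩, hbb⟩, hs⟩
        refine ⟨⟨⟨?_, hy⟩, fun h => ha (conn_symm h)⟩, hs⟩
        rcases hbb with h | h
        · exact h
        · exact absurd (mem_root_of_conn p hex hs h) hb
      · rintro ⟨⟨⟨hbb, hy⟩, ha⟩, hs⟩
        exact ⟨⟨⟨⟨(sf hs).1, hy⟩, fun h => ha (conn_symm h), (sf hs).2⟩, Or.inl hbb⟩, hs⟩
    rw [e01e]
    nlinarith [hpΩ]

end LamBase

end KPrime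

end Summit.Ventures.PercRepro2
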